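import Summits.BirchSwinnertonDyer.Rank1Residual.X1.CongruenceTransfer
import Summits.BirchSwinnertonDyer.Rank1Residual.Iwasawa.UnitCoefficientCertificate
import HarnessLib

/-!
# "X4 ROUTE G", image-free core: the tame-branch MAIN CONJECTURE at `E` from Kato integrality + ONE
# unit coefficient + ONE typed lower bound on `λ(X(E/ℚ_∞))` — partner-free (`p`-Tamagawa budget) or
# via a congruent partner (team n1011, seat p10 gen 2, OWNERS row T-E3d; statements = route planner 2's
# ROUTE-2 II.10.2 / II.10.10 K-B, K-C, K-C′, K-F₀, K-F, sketch v2 `route2/e3/T-E3d-Sketch.lean`)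

HONEST FRAMING (cell `b2b-bsdres`, run/shared/lean/b2b/bsd-rank1-residual/, verbatim in every
file): the goal of the cell is to DELETE the COMBINATION-SHAPED residual classes of the
Birch–Swinnerton-Dyer formula for ALL analytic-rank `≤ 1` elliptic curves over `ℚ` — "full BSD
formula for every rank `≤ 1` curve in class `C`" assembled STRICTLY from published theorems — so
that the rank-`≤ 1` remainder becomes exactly the CONSTRUCTION-SHAPED classes, which are TYPED
(missing-input `Prop`s), NOT attempted. This is not "finishing BSD". Team n1011 (N10/N11: X4 ∧
`p = 3`; later O8): research routes on CONSTRUCTION-SHAPED classes; prove what is provable now; no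
claim beyond stated classes; census output = EVIDENCE / conjecture items, never a Literature fact;
RESIDUAL-MAP marks UNCHANGED; nothing is booked by this file. ONE definition (a typed per-curve
INPUT `BudgetLeLambdaAt`, nothing asserted) and theorems; NO named fact, NO conjecture node (R5-7).

## What and why (ROUTE-2 §II.9–II.10, r2 gens 3–4; lead R5-7 / R5-12 / R5-20 / R5-22 (c))

On an X4 row (`E` additive at `p`) of semistability defect `e = 2` the cyclotomic main conjecture
for `X(E/ℚ_∞)` is attacked on the `ω^{(p−1)/2}`-branch of the semistable twist `E♭ = E^{(p*)}`
(additive-p1/p2 transport [C]); Kato's divisibility there (`Wuthrich2014.kato_halfEigenCharIdeal_…`)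
yields, for EVERY cyclotomic Pontryagin-dual datum `D` of `Sel_{p^∞}(E/ℚ_∞)` (currency A =
`W.SelmerDualData κ γ`), `X` torsion and an INTEGRAL `g ∈ char_Λ X` with `ι g = C(u·ϖ)·B` (additive-p2
gen 19 `isTorsion_and_exists_iota_eq_branch_of_katoComponent`). To turn the inclusion `fE ∣ g` into
the equality `(g) = (fE)` one needs `lam g ≤ lam fE` (`Iwasawa.span_eq_span_of_dvd_of_lam_le`, iw-1):
an UPPER bound on `lam g` — ONE unit coefficient `‖[Tⁿ](ϖ·B)‖_p = 1` (per-pair ENGINE value; it also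
gives `μ(g) = 0`, §1) — and a LOWER bound `n ≤ λ(X(E/ℚ_∞))`. Three sources of the lower bound:
* `n = rank E(ℚ)` (`Typed.X_pow_mordellWeilRank_dvd_of_charIdeal_eq_span`): additive-p2 gen 19 /
  T-O7K3 (`Iwasawa.minimal_package`) — not repeated here except inside K-B;
* **K-F₀ `BudgetLeLambdaAt p W b`** (§0, TYPED per-curve input, nothing asserted): "`μ(X) = 0 ⟹
  b ≤ λ(X)`" — for `b = B(E,p)` the `p`-Tamagawa budget (ROUTE-2 II.9.2) this is Emerton–Pollack–Weston
  2006 Cor. 3.2.5 (the residual Selmer sequence surjects onto `∏_{v ∣ N} A_f^{G_v}/π`) + Thm. 3.1.1 (no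
  finite submodules) + the local dictionary `dim A^{G_v}/π = [p ∣ c_ℓ(E)]` (II.10.9) — discharged PER
  CURVE outside the kernel, exactly as X1's route G takes `CongruentLambdaShift` from Greenberg–Vatsal
  §2. **K-F `budgetSqueeze`** (§2): Kato-integral `fE ∣ g` with unit content, `lam g ≤ b`, K-F₀ ⟹
  `(g) = (fE)`, `μ(X) = 0`, `λ(X) = b` — the PARTNER-FREE closure of an "eligible" row;
* **a congruent partner `E₁`** (X1's typed schema `X1.CongruenceTransfer.TorsionIso` /
  `CongruentLambdaShift W W₁ p e`, reduction-agnostic as defined; per pair = EPW Thm. 3.3.3,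
  `e = B(E,p) − B(E₁,p)`): **K-B `partnerPackage`** (§3: MC + `λ = r₁` at a partner with
  `r₁ ≤ rank E₁(ℚ)` and a unit coefficient at index `r₁`), **K-C `transferSqueeze`** and **K-C′
  `transferSqueezeGe`** (§4: MC at `E` with `λ(X(E)) = r₁ + e` from the partner's `μ = 0` and
  `λ(X(E₁)) = r₁`, resp. only `r₁ ≤ λ(X(E₁))` — no certificate at the partner, and then
  `λ(X(E₁)) = r₁` a posteriori).
* **K-F♯ `budgetSqueezeSharp`** (OWNERS row T-E3f, route planner 2 gen 5, ROUTE-2 II.11.3 (iv)) lives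
  in the sibling file `CongruentPartnerMainConjectureParity.lean`: with ONE more typed per-curve input
  `LambdaParityAt p W ε` ("`λ(X) + ε` is even", nothing asserted; intended discharge `ε = rank E(ℚ)`
  by Greenberg LNM 1716 Prop. 3.10 + `Ш(E/ℚ)[p^∞]` finite) and `b + ε` ODD, a unit coefficient at
  index `b + 1` closes the main conjecture partner-free with `λ(X) = b + 1`.
Everything here is IMAGE-FREE Λ-algebra over `W.SelmerDualData` (lead R5-20 (c): `Surj`, Kato
integrality and the twist model enter only in the per-pair wrappers, file
`CongruentPartnerMainConjectureGord.lean`), so the same core serves O8's twist-ordinary cells.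
What is NOT claimed: any per-pair binder (TorsionIso, `e`, `b`, `r₁ ≤ rank`, the unit coefficient,
`μ(X(E₁)) = 0`) — all instrument tier / typed schemata, EVIDENCE until certified; no class theorem;
nothing booked; e ∈ {3,4,6}, wild `3`, `p = 2` untouched.

References: M. Emerton, R. Pollack, T. Weston, Invent. Math. 163 (2006) [EmertonPollackWeston2006]
§3 (Thm. 3.1.1, Cor. 3.2.5, Thm. 3.3.2/3.3.3 — arXiv math/0404484 numbering), §5; R. Greenberg,
V. Vatsal, Invent. Math. 142 (2000) §2 [GreenbergVatsal2000]; L. Washington, GTM 83 §13.2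
[Washington1997]; R. Greenberg, LNM 1716 (1999) §3 Lemma 3.1, Prop. 3.10 [GreenbergLNM1716].
-/

set_option autoImplicit false

noncomputable section

open scoped Classical MatrixGroups ModularForm

open CongruenceSubgroup WeierstrassCurve Literature.NumberTheory.EllipticCurves
  Literature.NumberTheory.EllipticCurves.ModularForms
  Literature.NumberTheory.EllipticCurves.Rank1Residual
  Literature.NumberTheory.EllipticCurves.Rank1Residual.Typed
  Literature.NumberTheory.EllipticCurves.Wuthrich2014
  Literature.NumberTheory.EllipticCurves.GreenbergVatsal2000
  Summit.BirchSwinnertonDyer.Rank1Residual.X1.MuLambda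
  Summit.BirchSwinnertonDyer.Rank1Residual.X11a
  Summit.BirchSwinnertonDyer.Rank1Residual.X11a.LambdaNorm
  Summit.BirchSwinnertonDyer.Rank1Residual.Iwasawa

open Summit.BirchSwinnertonDyer.Rank1Residual.X1.CongruenceTransfer (TorsionIso CongruentLambdaShift)
open Summit.BirchSwinnertonDyer.Rank1Residual.X1.MuPart (mu_generator_eq_muInvariant)
open Summit.BirchSwinnertonDyer.Rank1Residual.X1.ParitySqueeze (lam_generator_eq_lambdaInvariant
  lam_eq_zero_of_isUnit)

namespace Summit.BirchSwinnertonDyer.Rank1Residual.Additive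

variable (p : ℕ) [Fact p.Prime]

/-! ### §0 K-F₀: the typed per-curve lower bound `μ(X) = 0 ⟹ b ≤ λ(X(E/ℚ_∞))` -/

/-- **K-F₀ — TYPED INPUT (nothing asserted): the `p`-Tamagawa budget bounds `λ` from below.** For
the cyclotomic `ℤ_p`-extension `κ` with topological generator `γ` matching the cyclotomic variable and
EVERY finitely generated torsion Pontryagin-dual datum `D` of `Sel_{p^∞}(E/ℚ_∞)` with `μ(D.X) = 0`:
`b ≤ λ(D.X)`. Intended per-curve discharge (OUTSIDE the kernel), with `b = B(E,p) = Σ_{ℓ ≠ p, p ∣ c_ℓ(E)} s_ℓ`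
the `p`-Tamagawa budget (ROUTE-2 II.9.2): Emerton–Pollack–Weston 2006 Cor. 3.2.5 (the residual Selmer
group surjects onto `∏_{v ∣ N} A_f^{G_v}/π`) + Thm. 3.1.1 (no finite submodules ⇒ `λ = dim_k Sel[π]`
when `μ = 0`) + the local dictionary `dim A^{G_v}/π = [p ∣ c_ℓ(E)]` (II.10.9). A predicate on
`(p, W, b)`; route planner 2's `BudgetLeLambdaAt` verbatim.
[cite: EmertonPollackWeston2006, Cor. 3.2.5 and Thm. 3.1.1 (shape of the intended discharge; nothing asserted)]
[cite: GreenbergLNM1716, §3 Lemma 3.1 (λ as a length; shape only)] -/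
def BudgetLeLambdaAt (W : WeierstrassCurve ℚ) [W.IsElliptic] [W.IsGloballyMinimal] (b : ℕ) : Prop :=
  ∀ {κ : ZpExtension ℚ p} {γ : Field.absoluteGaloisGroup ℚ},
    κ.IsCyclotomic → κ.IsTopGenerator γ → IsCyclotomicVariable p γ →
    ∀ (D : W.SelmerDualData κ γ) [Module.Finite (IwasawaAlgebra p) D.X],
      D.IsTorsion → D.mu = 0 → b ≤ lambdaInvariant p D.X

variable {p}

/-! ### §1 K-G: ONE unit coefficient gives unit content and an upper bound on `λ` -/

/-- A unit coefficient `‖[Tⁿ] g‖ = 1` gives `μ(g) = 0` (unit content) and `λ(g) ≤ n`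
(`λ = normLam`, and `n` is an index of maximal norm). [cite: Washington1997, §7.1 (μ, λ of a power series)] -/
theorem hasUnitContent_and_lam_le_of_norm_coeff_eq_one {g : IwasawaAlgebra p} {n : ℕ}
    (h1 : ‖PowerSeries.coeff n g‖ = 1) : HasUnitContent g ∧ lam g ≤ n := by
  have hg : HasUnitContent g := (hasUnitContent_iff_exists_norm_eq_one g).mpr ⟨n, h1⟩
  refine ⟨hg, ?_⟩
  rw [lam_eq_normLam hg]
  exact normLam_le_of_isMaxCoeffAt (isMaxCoeffAt_of_norm_eq_one h1)

/-- **K-G.** From the full-series identity `ι g = C(u·ϖ)·B` (`u ∈ ℤ_pˣ`, the shape delivered by the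
Kato χ-branch fact) and ONE unit coefficient of the Néron-normalised series, `‖[Tⁿ](ϖ·B)‖_p = 1`:
`g` has unit content (`μ(g) = 0`) and `λ(g) ≤ n`. The index-`n` form of additive-p2 gen 19's
`constantCoeff_eq_zero_and_isUnit_coeff_one_of_iota_eq`. [cite: Washington1997, §7.1] -/
theorem hasUnitContent_and_lam_le_of_iota_eq_of_norm_coeff_eq_one {g : IwasawaAlgebra p}
    {u : ℤ_[p]ˣ} {ϖ : ℚ} {B : PowerSeries ℚ_[p]} {n : ℕ}
    (hι : iwasawaToPowerSeries p g = PowerSeries.C (((u : ℤ_[p]) : ℚ_[p]) * (ϖ : ℚ_[p])) * B)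
    (hn : ‖PowerSeries.coeff n (PowerSeries.C (ϖ : ℚ_[p]) * B)‖ = 1) :
    HasUnitContent g ∧ lam g ≤ n := by
  refine hasUnitContent_and_lam_le_of_norm_coeff_eq_one ?_
  have e1 := coeff_iwasawaToPowerSeries p g n
  rw [hι, PowerSeries.coeff_C_mul] at e1
  rw [PowerSeries.coeff_C_mul] at hn
  have hu : ‖((u : ℤ_[p]) : ℚ_[p])‖ = 1 := by
    rw [← PadicInt.norm_def]
    exact PadicInt.isUnit_iff.mp u.isUnit
  rw [PadicInt.norm_def, ← e1, mul_assoc, norm_mul, hu, hn, one_mul]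

/-! ### §2 K-F: the PARTNER-FREE budget squeeze -/

section Core

variable {W : WeierstrassCurve ℚ} [W.IsElliptic] [W.IsGloballyMinimal]
  {κ : ZpExtension ℚ p} {γ : Field.absoluteGaloisGroup ℚ}

omit [W.IsElliptic] [W.IsGloballyMinimal] in
/-- **Core squeeze (cell-agnostic).** For a torsion dual datum `D` with `char = (fE)`, an element `g`
with unit content and `fE ∣ g`, and `lam g ≤ n ≤ λ(D.X)`: `(g) = (fE)`, `μ(D.X) = 0`, `λ(D.X) = n`.
[cite: Washington1997, §13.2 (structure theory: μ, λ of a generator of char)] -/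
theorem span_eq_and_mu_zero_and_lambda_eq_of_dvd_of_lam_le_of_le
    (D : W.SelmerDualData κ γ) [Module.Finite (IwasawaAlgebra p) D.X] {fE g : IwasawaAlgebra p}
    (hX : D.IsTorsion) (hchar : D.charIdeal = Ideal.span {fE}) (hg : HasUnitContent g)
    (hdvd : fE ∣ g) {n : ℕ} (hle : lam g ≤ n) (hge : n ≤ lambdaInvariant p D.X) :
    Ideal.span ({g} : Set (IwasawaAlgebra p)) = Ideal.span {fE} ∧ D.mu = 0 ∧
      lambdaInvariant p D.X = n := by
  obtain ⟨h, hfac⟩ := hdvd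
  have hg0 : g ≠ 0 := ne_zero_of_hasUnitContent hg
  have hfE : HasUnitContent fE := hasUnitContent_left_of_mul (a := fE) (b := h) (hfac ▸ hg)
  have hfE0 : fE ≠ 0 := ne_zero_of_hasUnitContent hfE
  have hh0 : h ≠ 0 := by
    rintro rfl
    exact hg0 (by rw [hfac, mul_zero])
  have hlamD : lam fE = lambdaInvariant p D.X := lam_generator_eq_lambdaInvariant D.X hX hfE0 hchar
  have h2 : lam fE ≤ lam g := by rw [hfac]; exact lam_le_lam_mul hfE0 hh0
  have hle' : lam g ≤ lam fE := by rw [hlamD]; exact hle.trans hge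
  refine ⟨span_eq_span_of_dvd_of_lam_le hg ⟨h, hfac⟩ hle', ?_, ?_⟩
  · rw [SelmerDualData.mu, ← mu_generator_eq_muInvariant D.X hX hfE0 hchar]
    exact mu_eq_zero_of_hasUnitContent hfE
  · rw [← hlamD]
    exact le_antisymm (h2.trans hle) (hlamD ▸ hge)

omit [W.IsElliptic] [W.IsGloballyMinimal] in
/-- `μ(D.X) = 0` as soon as `char = (fE)` and `fE` divides an element with unit content (no λ input).
[cite: Washington1997, §13.2] -/
theorem mu_zero_of_charIdeal_eq_span_of_dvd (D : W.SelmerDualData κ γ)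
    [Module.Finite (IwasawaAlgebra p) D.X] {fE g : IwasawaAlgebra p} (hX : D.IsTorsion)
    (hchar : D.charIdeal = Ideal.span {fE}) (hg : HasUnitContent g) (hdvd : fE ∣ g) : D.mu = 0 := by
  obtain ⟨h, hfac⟩ := hdvd
  have hfE : HasUnitContent fE := hasUnitContent_left_of_mul (a := fE) (b := h) (hfac ▸ hg)
  rw [SelmerDualData.mu, ← mu_generator_eq_muInvariant D.X hX (ne_zero_of_hasUnitContent hfE) hchar]
  exact mu_eq_zero_of_hasUnitContent hfE

variable (p W) in
/-- **K-F — the partner-free BUDGET SQUEEZE.** Given the typed input `BudgetLeLambdaAt p W b`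
(`μ = 0 ⟹ b ≤ λ(X)`), for the cyclotomic data and every finitely generated torsion dual datum `D` with
`char = (fE)`: an element `g` with unit content and `fE ∣ g` (Kato integrality) whose `λ(g) ≤ b`
(one unit coefficient at index `b`) forces the main conjecture `(g) = (fE)` with `μ(X) = 0` and
`λ(X) = b`. Route planner 2's `BudgetSqueezeAt p W b`, as a theorem.
[cite: EmertonPollackWeston2006, Cor. 3.2.5 and Thm. 3.1.1 (source of the typed input)]
[cite: Washington1997, §13.2] -/
theorem budgetSqueeze {b : ℕ} (hbud : BudgetLeLambdaAt p W b)
    (hκ : κ.IsCyclotomic) (hγ : κ.IsTopGenerator γ) (hγ' : IsCyclotomicVariable p γ)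
    (D : W.SelmerDualData κ γ) [Module.Finite (IwasawaAlgebra p) D.X] {fE g : IwasawaAlgebra p}
    (hX : D.IsTorsion) (hchar : D.charIdeal = Ideal.span {fE}) (hg : HasUnitContent g)
    (hdvd : fE ∣ g) (hle : lam g ≤ b) :
    Ideal.span ({g} : Set (IwasawaAlgebra p)) = Ideal.span {fE} ∧ D.mu = 0 ∧
      lambdaInvariant p D.X = b :=
  span_eq_and_mu_zero_and_lambda_eq_of_dvd_of_lam_le_of_le D hX hchar hg hdvd hle
    (hbud hκ hγ hγ' D hX (mu_zero_of_charIdeal_eq_span_of_dvd D hX hchar hg hdvd))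

/-! ### §3 K-B: the PARTNER package (`r₁ ≤ rank E₁(ℚ)`, unit coefficient at index `r₁`) -/

variable (p W) in
omit [W.IsGloballyMinimal] in
/-- **K-B — main conjecture and `λ = r₁` at a partner.** For `W₁/ℚ` globally minimal (ANY reduction
at `p`), the cyclotomic data and every finitely generated torsion dual datum `D₁` with `char = (fE₁)`:
an element `g₁` with unit content and `fE₁ ∣ g₁`, `r₁ ≤ rank W₁(ℚ)` (so `T^{r₁} ∣ fE₁`,
`Typed.X_pow_mordellWeilRank_dvd_of_charIdeal_eq_span`) and `λ(g₁) ≤ r₁` give `(g₁) = (fE₁)`,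
`μ(X₁) = 0`, `λ(X₁) = r₁` (`Iwasawa.minimal_package`). Route planner 2's `PartnerPackageAt p W₁ r₁`, as
a theorem; `r₁ = 0`: a unit partner, `r₁ = 2`: a rank partner (II.9.3 variants (a)/(c)).
[cite: GreenbergLNM1716, §3 Lemma 3.1 (T^{rank} ∣ char)] [cite: Washington1997, §13.2] -/
theorem partnerPackage {r₁ : ℕ}
    (hγ : κ.IsTopGenerator γ) (D₁ : W.SelmerDualData κ γ) [Module.Finite (IwasawaAlgebra p) D₁.X]
    {fE₁ g₁ : IwasawaAlgebra p} (hX : D₁.IsTorsion) (hchar : D₁.charIdeal = Ideal.span {fE₁})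
    (hg : HasUnitContent g₁) (hdvd : fE₁ ∣ g₁) (hr : r₁ ≤ W.mordellWeilRank) (hle : lam g₁ ≤ r₁) :
    Ideal.span ({g₁} : Set (IwasawaAlgebra p)) = Ideal.span {fE₁} ∧ D₁.mu = 0 ∧
      lambdaInvariant p D₁.X = r₁ := by
  have hXr : (PowerSeries.X : IwasawaAlgebra p) ^ r₁ ∣ fE₁ :=
    (pow_dvd_pow _ hr).trans (X_pow_mordellWeilRank_dvd_of_charIdeal_eq_span W p hγ D₁ hX hchar)
  have hfE : HasUnitContent fE₁ := by
    obtain ⟨h, hfac⟩ := hdvd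
    exact hasUnitContent_left_of_mul (a := fE₁) (b := h) (hfac ▸ hg)
  have hge : r₁ ≤ lambdaInvariant p D₁.X := by
    rw [← lam_generator_eq_lambdaInvariant D₁.X hX (ne_zero_of_hasUnitContent hfE) hchar]
    exact le_lam_of_X_pow_dvd hfE hXr
  exact span_eq_and_mu_zero_and_lambda_eq_of_dvd_of_lam_le_of_le D₁ hX hchar hg hdvd hle hge

omit [W.IsGloballyMinimal] in
/-- **Lower bound without a certificate**: `rank W(ℚ) ≤ λ(X(E/ℚ_∞))` whenever `char = (fE)` with `fE`
dividing an element of unit content (so `μ = 0` and `λ(fE) = λ(X)`); in particular any `r₁ ≤ rank`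
is `≤ λ(X)` — the partner-side input of K-C′. [cite: GreenbergLNM1716, §3 Lemma 3.1] -/
theorem le_lambdaInvariant_of_le_mordellWeilRank {r₁ : ℕ}
    (hγ : κ.IsTopGenerator γ) (D₁ : W.SelmerDualData κ γ) [Module.Finite (IwasawaAlgebra p) D₁.X]
    {fE₁ g₁ : IwasawaAlgebra p} (hX : D₁.IsTorsion) (hchar : D₁.charIdeal = Ideal.span {fE₁})
    (hg : HasUnitContent g₁) (hdvd : fE₁ ∣ g₁) (hr : r₁ ≤ W.mordellWeilRank) :
    r₁ ≤ lambdaInvariant p D₁.X := by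
  have hXr : (PowerSeries.X : IwasawaAlgebra p) ^ r₁ ∣ fE₁ :=
    (pow_dvd_pow _ hr).trans (X_pow_mordellWeilRank_dvd_of_charIdeal_eq_span W p hγ D₁ hX hchar)
  have hfE : HasUnitContent fE₁ := by
    obtain ⟨h, hfac⟩ := hdvd
    exact hasUnitContent_left_of_mul (a := fE₁) (b := h) (hfac ▸ hg)
  rw [← lam_generator_eq_lambdaInvariant D₁.X hX (ne_zero_of_hasUnitContent hfE) hchar]
  exact le_lam_of_X_pow_dvd hfE hXr

end Core

/-! ### §4 K-C / K-C′: the CONGRUENT-PARTNER transfer and the squeeze at `E` -/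

section Transfer

variable {W W₁ : WeierstrassCurve ℚ} [W.IsElliptic] [W.IsGloballyMinimal] [W₁.IsElliptic]
  [W₁.IsGloballyMinimal] {κ : ZpExtension ℚ p} {γ : Field.absoluteGaloisGroup ℚ}

variable (p W W₁) in
/-- **K-C′ — transfer + squeeze at `E`, NO certificate at the partner.** `E[p] ≅ E₁[p]`
(`TorsionIso`), the typed schema `CongruentLambdaShift W W₁ p e` (per pair: EPW 2006 Thm. 3.3.3,
`e = B(E,p) − B(E₁,p)`), a torsion datum `D₁` of the partner with `μ(X(E₁)) = 0` and the LOWER bound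
`r₁ ≤ λ(X(E₁))` (e.g. `le_lambdaInvariant_of_le_mordellWeilRank`), and at `E`: `char = (fE)`, `g` with
unit content, `fE ∣ g` (Kato integrality) and `λ(g) ≤ r₁ + e` (ONE unit coefficient at index
`r₁ + e`). Then the main conjecture holds at `E`: `(g) = (fE)`, `μ(X(E)) = 0`, `λ(X(E)) = r₁ + e` —
and a posteriori `λ(X(E₁)) = r₁` (fail-closed: if `λ(X(E₁)) > r₁` the certificate at `E` cannot
hold). Route planner 2's `TransferSqueezeGeAt p W W₁ r₁ e`, as a theorem.
READING OF RECORD for the schema (referee 1 ACK-1 proviso P1, 2026-08-21): per additive pair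
EPW 2006 Thm. 3.3.3 is applied in its `ω^i`-form (LIT-INPUTS-P3 §11.1, arXiv math/0404484 p0019
L147–166) on the HIDA FAMILY of `ρ̄_{E♭}` — the `p`-ordinary twist model — at `i = (p−1)/2`, NEVER
on `f_E` itself (`a_p(E) = 0`); `e = B(E,p) − B(E₁,p)`, `b = B(E,p)` the `p`-Tamagawa budget (P2).
[cite: EmertonPollackWeston2006, Thm. 3.3.3 (source of the typed schema)]
[cite: GreenbergVatsal2000, §2 Prop. (2.8), Cor. (2.3) (shape of the schema)] [cite: Washington1997, §13.2] -/
theorem transferSqueezeGe {r₁ : ℕ} {e : ℤ} (hiso : TorsionIso W W₁ p)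
    (hG : CongruentLambdaShift W W₁ p e)
    (hκ : κ.IsCyclotomic) (hγ : κ.IsTopGenerator γ) (hγ' : IsCyclotomicVariable p γ)
    (D : W.SelmerDualData κ γ) (D₁ : W₁.SelmerDualData κ γ)
    [Module.Finite (IwasawaAlgebra p) D.X] [Module.Finite (IwasawaAlgebra p) D₁.X]
    {fE g : IwasawaAlgebra p} (hX : D.IsTorsion) (hX₁ : D₁.IsTorsion) (hmu₁ : D₁.mu = 0)
    (hr₁ : r₁ ≤ lambdaInvariant p D₁.X) (hchar : D.charIdeal = Ideal.span {fE})
    (hg : HasUnitContent g) (hdvd : fE ∣ g) (hle : (lam g : ℤ) ≤ r₁ + e) :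
    Ideal.span ({g} : Set (IwasawaAlgebra p)) = Ideal.span {fE} ∧ D.mu = 0 ∧
      (lambdaInvariant p D.X : ℤ) = r₁ + e ∧ lambdaInvariant p D₁.X = r₁ := by
  have hmu : D.mu = 0 := mu_zero_of_charIdeal_eq_span_of_dvd D hX hchar hg hdvd
  -- the schema: `λ(X(E)) = λ(X(E₁)) + e`
  have hshift : (lambdaInvariant p D.X : ℤ) = (lambdaInvariant p D₁.X : ℤ) + e :=
    hG hiso κ γ hκ hγ hγ' D D₁ hX hX₁ hmu hmu₁
  -- so `λ(X(E)) ≥ r₁ + e ≥ lam g`, and the squeeze runs at the natural number `λ(X(E))`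
  have hn : lam g ≤ lambdaInvariant p D.X := by
    have : (lam g : ℤ) ≤ lambdaInvariant p D.X := by rw [hshift]; omega
    exact_mod_cast this
  obtain ⟨hspan, -, -⟩ :=
    span_eq_and_mu_zero_and_lambda_eq_of_dvd_of_lam_le_of_le D hX hchar hg hdvd hn le_rfl
  -- `λ(X(E)) = lam g ≤ r₁ + e ≤ λ(X(E₁)) + e = λ(X(E))`: everything is an equality
  have hg0 : g ≠ 0 := ne_zero_of_hasUnitContent hg
  have hfE0 : fE ≠ 0 := by
    obtain ⟨h, hfac⟩ := hdvd
    exact ne_zero_of_hasUnitContent (hasUnitContent_left_of_mul (a := fE) (b := h) (hfac ▸ hg))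
  have hlamg : lam g = lambdaInvariant p D.X := by
    obtain ⟨u, hu⟩ := Ideal.span_singleton_eq_span_singleton.mp hspan
    rw [← lam_generator_eq_lambdaInvariant D.X hX hfE0 hchar, ← hu, lam_mul hg0 u.ne_zero,
      lam_eq_zero_of_isUnit u.isUnit, add_zero]
  refine ⟨hspan, hmu, ?_, ?_⟩
  · have h1 : (lambdaInvariant p D.X : ℤ) ≤ r₁ + e := by rw [← hlamg]; exact hle
    have h2 : (r₁ : ℤ) + e ≤ lambdaInvariant p D.X := by rw [hshift]; omega
    exact le_antisymm h1 h2
  · have h1 : (lambdaInvariant p D.X : ℤ) ≤ r₁ + e := by rw [← hlamg]; exact hle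
    rw [hshift] at h1
    have : lambdaInvariant p D₁.X ≤ r₁ := by exact_mod_cast (by omega : (lambdaInvariant p D₁.X : ℤ) ≤ r₁)
    exact le_antisymm this hr₁

variable (p W W₁) in
/-- **K-C — transfer + squeeze at `E` from the partner PACKAGE** (`μ(X(E₁)) = 0`, `λ(X(E₁)) = r₁`, e.g.
K-B `partnerPackage`): as K-C′ with the partner's `λ` known exactly. Route planner 2's
`TransferSqueezeAt p W W₁ r₁ e`, as a theorem.
READING OF RECORD for the schema (referee 1 ACK-1 proviso P1, 2026-08-21): per additive pair
EPW 2006 Thm. 3.3.3 is applied in its `ω^i`-form (LIT-INPUTS-P3 §11.1, arXiv math/0404484 p0019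
L147–166) on the HIDA FAMILY of `ρ̄_{E♭}` — the `p`-ordinary twist model — at `i = (p−1)/2`, NEVER
on `f_E` itself (`a_p(E) = 0`); `e = B(E,p) − B(E₁,p)`, `b = B(E,p)` the `p`-Tamagawa budget (P2).
[cite: EmertonPollackWeston2006, Thm. 3.3.3]
[cite: GreenbergVatsal2000, §2 Prop. (2.8), Cor. (2.3)] [cite: Washington1997, §13.2] -/
theorem transferSqueeze {r₁ : ℕ} {e : ℤ} (hiso : TorsionIso W W₁ p)
    (hG : CongruentLambdaShift W W₁ p e)
    (hκ : κ.IsCyclotomic) (hγ : κ.IsTopGenerator γ) (hγ' : IsCyclotomicVariable p γ)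
    (D : W.SelmerDualData κ γ) (D₁ : W₁.SelmerDualData κ γ)
    [Module.Finite (IwasawaAlgebra p) D.X] [Module.Finite (IwasawaAlgebra p) D₁.X]
    {fE g : IwasawaAlgebra p} (hX : D.IsTorsion) (hX₁ : D₁.IsTorsion) (hmu₁ : D₁.mu = 0)
    (hlam₁ : lambdaInvariant p D₁.X = r₁) (hchar : D.charIdeal = Ideal.span {fE})
    (hg : HasUnitContent g) (hdvd : fE ∣ g) (hle : (lam g : ℤ) ≤ r₁ + e) :
    Ideal.span ({g} : Set (IwasawaAlgebra p)) = Ideal.span {fE} ∧ D.mu = 0 ∧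
      (lambdaInvariant p D.X : ℤ) = r₁ + e := by
  obtain ⟨h1, h2, h3, -⟩ := transferSqueezeGe p W W₁ hiso hG hκ hγ hγ' D D₁ hX hX₁ hmu₁ hlam₁.ge
    hchar hg hdvd hle
  exact ⟨h1, h2, h3⟩

variable (p W W₁) in
/-- **K-B + K-C composed: the rank-partner route in one statement.** Partner `W₁` with
`r₁ ≤ rank W₁(ℚ)`, Kato integrality `fE₁ ∣ g₁` with unit content and `λ(g₁) ≤ r₁` (certificate at the
partner); at `E`: `TorsionIso`, `CongruentLambdaShift … e`, `fE ∣ g` with unit content and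
`λ(g) ≤ r₁ + e`. Then MC holds at BOTH curves, with `λ(X(E₁)) = r₁`, `λ(X(E)) = r₁ + e`, both `μ = 0`.
READING OF RECORD for the schema (referee 1 ACK-1 proviso P1, 2026-08-21): per additive pair
EPW 2006 Thm. 3.3.3 is applied in its `ω^i`-form (LIT-INPUTS-P3 §11.1, arXiv math/0404484 p0019
L147–166) on the HIDA FAMILY of `ρ̄_{E♭}` — the `p`-ordinary twist model — at `i = (p−1)/2`, NEVER
on `f_E` itself (`a_p(E) = 0`); `e = B(E,p) − B(E₁,p)`, `b = B(E,p)` the `p`-Tamagawa budget (P2).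
[cite: EmertonPollackWeston2006, Thm. 3.3.3] [cite: GreenbergLNM1716, §3 Lemma 3.1] -/
theorem transferSqueeze_of_partner {r₁ : ℕ} {e : ℤ} (hiso : TorsionIso W W₁ p)
    (hG : CongruentLambdaShift W W₁ p e)
    (hκ : κ.IsCyclotomic) (hγ : κ.IsTopGenerator γ) (hγ' : IsCyclotomicVariable p γ)
    (D : W.SelmerDualData κ γ) (D₁ : W₁.SelmerDualData κ γ)
    [Module.Finite (IwasawaAlgebra p) D.X] [Module.Finite (IwasawaAlgebra p) D₁.X]
    {fE g fE₁ g₁ : IwasawaAlgebra p} (hX : D.IsTorsion) (hX₁ : D₁.IsTorsion)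
    (hchar₁ : D₁.charIdeal = Ideal.span {fE₁}) (hg₁ : HasUnitContent g₁) (hdvd₁ : fE₁ ∣ g₁)
    (hr₁ : r₁ ≤ W₁.mordellWeilRank) (hle₁ : lam g₁ ≤ r₁)
    (hchar : D.charIdeal = Ideal.span {fE}) (hg : HasUnitContent g) (hdvd : fE ∣ g)
    (hle : (lam g : ℤ) ≤ r₁ + e) :
    (Ideal.span ({g₁} : Set (IwasawaAlgebra p)) = Ideal.span {fE₁} ∧ D₁.mu = 0 ∧
        lambdaInvariant p D₁.X = r₁) ∧
      (Ideal.span ({g} : Set (IwasawaAlgebra p)) = Ideal.span {fE} ∧ D.mu = 0 ∧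
        (lambdaInvariant p D.X : ℤ) = r₁ + e) := by
  obtain ⟨hs₁, hm₁, hl₁⟩ := partnerPackage p W₁ hγ D₁ hX₁ hchar₁ hg₁ hdvd₁ hr₁ hle₁
  exact ⟨⟨hs₁, hm₁, hl₁⟩,
    transferSqueeze p W W₁ hiso hG hκ hγ hγ' D D₁ hX hX₁ hm₁ hl₁ hchar hg hdvd hle⟩

end Transfer

end Summit.BirchSwinnertonDyer.Rank1Residual.Additive

end
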